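import Summits.Ventures.CertifiedManyBodySolver.Downfold.EmeryShapeTrueCornerRule
import Summits.Ventures.CertifiedManyBodySolver.Downfold.EmeryFermiScalePointsHg1223IPC1TrueCorners
import HarnessLib

/-!
# THE ONE-BAND FERMI-SURFACE SHAPE `t′/t` OF THE WHOLE TYPED 3BE BOX `emeryBoxHg1223IP (EmeryBoxesTrilayer) — t_pp′ PIECE [0.11, 0.145]` AT ITS TWO TRUE CORNERS (true-corner rule under certified margins, §B.87 (i);
# router/EMERY-SHAPE-CORNERS.tsv «true» rows)

Venture CertifiedManyBodySolver, cell `pub/hubbard-downfold` (stage S1; INFLATION-RULES-3to1-B §B.87 (i)), seat hubbard-downfold-mod-4 (technique B, g35); namespace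
`Summit.Ventures.CertifiedManyBodySolver.Downfold.Emery`. Everything PROVED (0 sorry). WHAT THIS IS NOT: a statement about HgBa₂Ca₂Cu₃O₈ INNER plane (typed companion) — the typed box is SCREENING-GRADE; `U = 0`
one-body kinematics of the σ model; object E = the EXACT `t–t′` shape of the σ Fermi surface at the row's own Fermi energy.

For EVERY one-body row of `[1.23, 2.02] × [1.16, 1.44] × [0.6, 0.76] × [0.11, 0.145]` eV the one-band `t′/t` lies between its values at the TRUE corners `(Δ₁, a₁, b₂, c₂)` and `(Δ₂, a₂, b₁, c₁)`
(`EmeryShapeTrueCornerRule`; the t_pp / t_pp′ directions by the MARGIN LEVERS of `EmeryMarginLevers`, margins certified by `norm_num` with the constants `M` printed below), read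
over their K = 384 brackets (`EmeryFermiScalePointsHg1223IPC1TrueCorners`).

| filling | **true-corner window (certified)** | margins (t_pp lower/upper; t_pp′ lower/upper) | two-ray (§B.86 (i)) | g19 sub-box device |
|---|---|---|---|---|
| n_H = 1.14 (ν = 43/100) | **[-0.3385, -0.2474]** | M_b 0.9711 / 4.1424; M_c 0.0 / 0.0 | see EmeryBoxesHg1223IPShapeCorners | [-0.3623,-0.243] (n_H band) |
| n_H = 1.20 (ν = 2/5) | **[-0.3388, -0.248]** | M_b 1.0129 / 4.1841; M_c 0.0 / 0.0 | see EmeryBoxesHg1223IPShapeCorners | [-0.3623,-0.243] (n_H band) |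

Sources: three-band model [HybertsenSchluterChristensen1989, Eq. (1)]; [AndersenEtAl1995, §6]; box rows as cited in the typed object's file.
-/

noncomputable section

namespace Summit.Ventures.CertifiedManyBodySolver.Downfold.Emery

open Real Set

/-- **n_H = 1.14 (ν = 43/100): for every row of the box the one-band Fermi-surface `t′/t` (object E) lies in `[-0.3385, -0.2474]` — its values at the two TRUE corners** (margin levers; margins by `norm_num`). [folklore] -/
theorem hg1223IPC1Box_fsRatio_true_nH114 {Δ a b c : ℝ} (hΔ : Δ ∈ Icc ((123 : ℝ) / 100) ((101 : ℝ) / 50)) (ha : a ∈ Icc ((29 : ℝ) / 25) ((36 : ℝ) / 25)) (hb : b ∈ Icc ((3 : ℝ) / 5) ((19 : ℝ) / 25)) (hc : c ∈ Icc ((11 : ℝ) / 100) ((29 : ℝ) / 200)) :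
    fsRatio Δ a b c (fermiEnergyOf Δ a b c ((43 : ℝ) / 100)) ∈ Icc ((-677 : ℝ) / 2000) ((-1237 : ℝ) / 5000) := by
  have hSL := (fermiEnergyOf_of_pointBracketCheck truePt_Hg1223IPC1SL_nH114_br (by norm_num) (by norm_num) (by norm_num) (ν := (43/100 : ℝ)) (by push_cast; exact ⟨le_rfl, le_rfl⟩)).2
  have hTL := (fermiEnergyOf_of_pointBracketCheck truePt_Hg1223IPC1TL_nH114_br (by norm_num) (by norm_num) (by norm_num) (ν := (43/100 : ℝ)) (by push_cast; exact ⟨le_rfl, le_rfl⟩)).2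
  have hSU := (fermiEnergyOf_of_pointBracketCheck truePt_Hg1223IPC1SU_nH114_br (by norm_num) (by norm_num) (by norm_num) (ν := (43/100 : ℝ)) (by push_cast; exact ⟨le_rfl, le_rfl⟩)).2
  have hQU := (fermiEnergyOf_of_pointBracketCheck truePt_Hg1223IPC1QU_nH114_br (by norm_num) (by norm_num) (by norm_num) (ν := (43/100 : ℝ)) (by push_cast; exact ⟨le_rfl, le_rfl⟩)).2
  have hTH := (fermiEnergyOf_of_pointBracketCheck truePt_Hg1223IPC1TH_nH114_br (by norm_num) (by norm_num) (by norm_num) (ν := (43/100 : ℝ)) (by push_cast; exact ⟨le_rfl, le_rfl⟩)).2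
  have hAlo := (fermiEnergyOf_of_pointBracketCheck truePt_Hg1223IPC1AL_nH114_br (by norm_num) (by norm_num) (by norm_num) (ν := (43/100 : ℝ)) (by push_cast; exact ⟨le_rfl, le_rfl⟩)).2
  have hTop := (fermiEnergyOf_of_pointBracketCheck truePt_Hg1223IPC1HH_nH114_br (by norm_num) (by norm_num) (by norm_num) (ν := (43/100 : ℝ)) (by push_cast; exact ⟨le_rfl, le_rfl⟩)).2
  push_cast at hSL hTL hSU hQU hTH hAlo hTop
  norm_num at hSL hTL hSU hQU hTH hAlo hTop
  obtain ⟨hΔl, hΔu⟩ := hΔ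
  obtain ⟨hal, hau⟩ := ha
  constructor
  · have hlow := fsRatio_fermiEnergyOf_trueCorner_lower (Δ₁ := ((123 : ℝ) / 100)) (a₁ := ((29 : ℝ) / 25)) (b₁ := ((3 : ℝ) / 5)) (b₂ := ((19 : ℝ) / 25)) (c₁ := ((11 : ℝ) / 100)) (c₂ := ((29 : ℝ) / 200))
      (ν := ((43 : ℝ) / 100)) (pL := ((213 : ℝ) / 125)) (qL := ((227 : ℝ) / 125)) (Mb := ((9711 : ℝ) / 10000)) (Mc := (0 : ℝ)) (by norm_num) hΔl (by norm_num) hal (by norm_num) hb (by norm_num) hc (by norm_num) (by norm_num) (by norm_num)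
      (by norm_num) hSL.1 hAlo.2 (by norm_num) (by norm_num [fsD, fsN]) (by norm_num) (by norm_num) (by norm_num [fsD, fsN]) (by norm_num) (by norm_num [dopingDisc]) (by norm_num [fsD, fsN])
    refine le_trans ?_ hlow
    have hw := (fsRatio_mem_Icc_on_window_of_dopingDisc_nonpos (Δ := ((123 : ℝ) / 100)) (a := ((29 : ℝ) / 25)) (b := ((19 : ℝ) / 25)) (c := ((29 : ℝ) / 200))
      (p := ((3531 : ℝ) / 2000)) (q := ((3561 : ℝ) / 2000)) (by norm_num) (by norm_num) (by norm_num) (by norm_num) (by norm_num) (by norm_num) (by norm_num) (by norm_num [dopingDisc]) hTL).1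
    refine le_trans ?_ hw
    norm_num [fsRatio, fsD, fsN]
  · have hup := fsRatio_fermiEnergyOf_trueCorner_upper (Δ₁ := ((123 : ℝ) / 100)) (Δ₂ := ((101 : ℝ) / 50)) (a₁ := ((29 : ℝ) / 25)) (a₂ := ((36 : ℝ) / 25)) (b₁ := ((3 : ℝ) / 5)) (b₂ := ((19 : ℝ) / 25)) (c₁ := ((11 : ℝ) / 100)) (c₂ := ((29 : ℝ) / 200))
      (ν := ((43 : ℝ) / 100)) (pU := ((19267 : ℝ) / 10000)) (qU := ((10109 : ℝ) / 5000)) (qT := ((23303 : ℝ) / 10000)) (Mb := ((2589 : ℝ) / 625)) (Mc := (0 : ℝ)) (by norm_num) ⟨hΔl, hΔu⟩ (by norm_num) ⟨hal, hau⟩ (by norm_num) hb (by norm_num) hc (by norm_num) (by norm_num) (by norm_num)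
      hTop.2 (by norm_num) (by norm_num) hSU.1 hQU.2 (by norm_num) (by norm_num [fsD, fsN]) (by norm_num) (by norm_num) (by norm_num [fsD, fsN]) (by norm_num) (by norm_num) (by norm_num [fsD, fsN])
    refine le_trans hup ?_
    have hw := (fsRatio_mem_Icc_on_window_of_dopingDisc_nonpos (Δ := ((101 : ℝ) / 50)) (a := ((36 : ℝ) / 25)) (b := ((3 : ℝ) / 5)) (c := ((11 : ℝ) / 100))
      (p := ((19627 : ℝ) / 10000)) (q := ((19727 : ℝ) / 10000)) (by norm_num) (by norm_num) (by norm_num) (by norm_num) (by norm_num) (by norm_num) (by norm_num) (by norm_num [dopingDisc]) hTH).2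
    refine le_trans hw ?_
    norm_num [fsRatio, fsD, fsN]

/-- **n_H = 1.20 (ν = 2/5): for every row of the box the one-band Fermi-surface `t′/t` (object E) lies in `[-0.3388, -0.248]` — its values at the two TRUE corners** (margin levers; margins by `norm_num`). [folklore] -/
theorem hg1223IPC1Box_fsRatio_true_nH120 {Δ a b c : ℝ} (hΔ : Δ ∈ Icc ((123 : ℝ) / 100) ((101 : ℝ) / 50)) (ha : a ∈ Icc ((29 : ℝ) / 25) ((36 : ℝ) / 25)) (hb : b ∈ Icc ((3 : ℝ) / 5) ((19 : ℝ) / 25)) (hc : c ∈ Icc ((11 : ℝ) / 100) ((29 : ℝ) / 200)) :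
    fsRatio Δ a b c (fermiEnergyOf Δ a b c ((2 : ℝ) / 5)) ∈ Icc ((-847 : ℝ) / 2500) ((-31 : ℝ) / 125) := by
  have hSL := (fermiEnergyOf_of_pointBracketCheck truePt_Hg1223IPC1SL_nH120_br (by norm_num) (by norm_num) (by norm_num) (ν := (2/5 : ℝ)) (by push_cast; exact ⟨le_rfl, le_rfl⟩)).2
  have hTL := (fermiEnergyOf_of_pointBracketCheck truePt_Hg1223IPC1TL_nH120_br (by norm_num) (by norm_num) (by norm_num) (ν := (2/5 : ℝ)) (by push_cast; exact ⟨le_rfl, le_rfl⟩)).2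
  have hSU := (fermiEnergyOf_of_pointBracketCheck truePt_Hg1223IPC1SU_nH120_br (by norm_num) (by norm_num) (by norm_num) (ν := (2/5 : ℝ)) (by push_cast; exact ⟨le_rfl, le_rfl⟩)).2
  have hQU := (fermiEnergyOf_of_pointBracketCheck truePt_Hg1223IPC1QU_nH120_br (by norm_num) (by norm_num) (by norm_num) (ν := (2/5 : ℝ)) (by push_cast; exact ⟨le_rfl, le_rfl⟩)).2
  have hTH := (fermiEnergyOf_of_pointBracketCheck truePt_Hg1223IPC1TH_nH120_br (by norm_num) (by norm_num) (by norm_num) (ν := (2/5 : ℝ)) (by push_cast; exact ⟨le_rfl, le_rfl⟩)).2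
  have hAlo := (fermiEnergyOf_of_pointBracketCheck truePt_Hg1223IPC1AL_nH120_br (by norm_num) (by norm_num) (by norm_num) (ν := (2/5 : ℝ)) (by push_cast; exact ⟨le_rfl, le_rfl⟩)).2
  have hTop := (fermiEnergyOf_of_pointBracketCheck truePt_Hg1223IPC1HH_nH120_br (by norm_num) (by norm_num) (by norm_num) (ν := (2/5 : ℝ)) (by push_cast; exact ⟨le_rfl, le_rfl⟩)).2
  push_cast at hSL hTL hSU hQU hTH hAlo hTop
  norm_num at hSL hTL hSU hQU hTH hAlo hTop
  obtain ⟨hΔl, hΔu⟩ := hΔ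
  obtain ⟨hal, hau⟩ := ha
  constructor
  · have hlow := fsRatio_fermiEnergyOf_trueCorner_lower (Δ₁ := ((123 : ℝ) / 100)) (a₁ := ((29 : ℝ) / 25)) (b₁ := ((3 : ℝ) / 5)) (b₂ := ((19 : ℝ) / 25)) (c₁ := ((11 : ℝ) / 100)) (c₂ := ((29 : ℝ) / 200))
      (ν := ((2 : ℝ) / 5)) (pL := ((823 : ℝ) / 500)) (qL := ((17433 : ℝ) / 10000)) (Mb := ((10129 : ℝ) / 10000)) (Mc := (0 : ℝ)) (by norm_num) hΔl (by norm_num) hal (by norm_num) hb (by norm_num) hc (by norm_num) (by norm_num) (by norm_num)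
      (by norm_num) hSL.1 hAlo.2 (by norm_num) (by norm_num [fsD, fsN]) (by norm_num) (by norm_num) (by norm_num [fsD, fsN]) (by norm_num) (by norm_num [dopingDisc]) (by norm_num [fsD, fsN])
    refine le_trans ?_ hlow
    have hw := (fsRatio_mem_Icc_on_window_of_dopingDisc_nonpos (Δ := ((123 : ℝ) / 100)) (a := ((29 : ℝ) / 25)) (b := ((19 : ℝ) / 25)) (c := ((29 : ℝ) / 200))
      (p := ((16933 : ℝ) / 10000)) (q := ((17083 : ℝ) / 10000)) (by norm_num) (by norm_num) (by norm_num) (by norm_num) (by norm_num) (by norm_num) (by norm_num) (by norm_num [dopingDisc]) hTL).1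
    refine le_trans ?_ hw
    norm_num [fsRatio, fsD, fsN]
  · have hup := fsRatio_fermiEnergyOf_trueCorner_upper (Δ₁ := ((123 : ℝ) / 100)) (Δ₂ := ((101 : ℝ) / 50)) (a₁ := ((29 : ℝ) / 25)) (a₂ := ((36 : ℝ) / 25)) (b₁ := ((3 : ℝ) / 5)) (b₂ := ((19 : ℝ) / 25)) (c₁ := ((11 : ℝ) / 100)) (c₂ := ((29 : ℝ) / 200))
      (ν := ((2 : ℝ) / 5)) (pU := ((9369 : ℝ) / 5000)) (qU := ((977 : ℝ) / 500)) (qT := ((22517 : ℝ) / 10000)) (Mb := ((41841 : ℝ) / 10000)) (Mc := (0 : ℝ)) (by norm_num) ⟨hΔl, hΔu⟩ (by norm_num) ⟨hal, hau⟩ (by norm_num) hb (by norm_num) hc (by norm_num) (by norm_num) (by norm_num)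
      hTop.2 (by norm_num) (by norm_num) hSU.1 hQU.2 (by norm_num) (by norm_num [fsD, fsN]) (by norm_num) (by norm_num) (by norm_num [fsD, fsN]) (by norm_num) (by norm_num) (by norm_num [fsD, fsN])
    refine le_trans hup ?_
    have hw := (fsRatio_mem_Icc_on_window_of_dopingDisc_nonpos (Δ := ((101 : ℝ) / 50)) (a := ((36 : ℝ) / 25)) (b := ((3 : ℝ) / 5)) (c := ((11 : ℝ) / 100))
      (p := ((19081 : ℝ) / 10000)) (q := ((19181 : ℝ) / 10000)) (by norm_num) (by norm_num) (by norm_num) (by norm_num) (by norm_num) (by norm_num) (by norm_num) (by norm_num [dopingDisc]) hTH).2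
    refine le_trans hw ?_
    norm_num [fsRatio, fsD, fsN]

end Summit.Ventures.CertifiedManyBodySolver.Downfold.Emery
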